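import Mathlib

/-!
# Crux `BinomialElusive.BinomialCandidate` (stmt-ValiantsHypothesis-7392), line `registered` —
# the stub `stub_expoCongruence`: arithmetic of the exponent family of the binomial curve

The route's binomial curve at arity `m` has exponents
`E_m(j) = Σ_{k ≤ h} (j · M)^k`, with `h = ⌊log₂ m⌋²` and `M = (2m+2)^{h+1}`, for `1 ≤ j ≤ 2m`.
The registered stub `stub_expoCongruence` of skeleton v2 records the two elementary facts about this
family that the jet argument against immersive integral formal solutions consumes (property (P2)):

* `E_m(j) ≡ 1 (mod M)` — the `k = 0` term is `1`, every other term `(jM)^k` is a multiple of `M`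
  (`ExpoCongruence.geom_sum_mul_mod`), and `M ≥ 2`;
* `2 · E_m(j) < M · E_m(j')` for all `1 ≤ j, j' ≤ 2m` — bound `E_m(j) ≤ (h+1) (2m)^h M^h`
  (each of the `h + 1` terms is at most the top one) and `E_m(j') ≥ M^h` (the top term alone), and
  use `2 (h+1) (2m)^h < (2m+2)^{h+1} = M` (`ExpoCongruence.two_mul_succ_mul_pow_lt`), which holds
  as soon as `1 ≤ h ≤ m`; for `m ≥ 16` one has `⌊log₂ m⌋ ≥ 4`, hence
  `h = ⌊log₂ m⌋² ≤ 2^{⌊log₂ m⌋} ≤ m` (`ExpoCongruence.sq_le_two_pow`).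

Everything is Mathlib-only natural-number arithmetic; the threshold is `m₀ = 16`.
-/

-- layout Summits/ValiantsHypothesis/ValiantsHypothesis forces the duplicated namespace component
set_option linter.dupNamespace false

namespace Summit.ValiantsHypothesis.ValiantsHypothesis.Theorems.BinomialCandidateStubs

open scoped BigOperators

namespace ExpoCongruence

/-- A geometric sum with ratio a multiple of `M` is `≡ 1 (mod M)`. -/
theorem geom_sum_mul_mod (a M n : ℕ) :
    (∑ k ∈ Finset.range (n + 1), (a * M) ^ k) % M = 1 % M := by
  rw [Finset.sum_range_succ', pow_zero]
  obtain ⟨c, hc⟩ : M ∣ ∑ k ∈ Finset.range n, (a * M) ^ (k + 1) :=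
    Finset.dvd_sum fun k _ => dvd_pow (dvd_mul_left M a) (Nat.succ_ne_zero k)
  rw [hc, Nat.mul_add_mod]

/-- A geometric sum with ratio `x ≥ 1` and `n + 1` terms is at most `(n + 1) x^n`. -/
theorem geom_sum_le (x n : ℕ) (hx : 1 ≤ x) :
    ∑ k ∈ Finset.range (n + 1), x ^ k ≤ (n + 1) * x ^ n := by
  calc ∑ k ∈ Finset.range (n + 1), x ^ k ≤ ∑ _k ∈ Finset.range (n + 1), x ^ n :=
        Finset.sum_le_sum fun k hk =>
          Nat.pow_le_pow_right hx (Nat.lt_succ_iff.mp (Finset.mem_range.mp hk))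
    _ = (n + 1) * x ^ n := by rw [Finset.sum_const, Finset.card_range, smul_eq_mul]

/-- The top term bounds a geometric sum from below. -/
theorem pow_le_geom_sum (x n : ℕ) : x ^ n ≤ ∑ k ∈ Finset.range (n + 1), x ^ k := by
  rw [Finset.sum_range_succ]
  exact Nat.le_add_left _ _

/-- The numerical heart: `2 (h+1) c^h < (c+2)^{h+1}` as soon as `1 ≤ h` and `2 h ≤ c`. -/
theorem two_mul_succ_mul_pow_lt (c h : ℕ) (hh : 1 ≤ h) (hhc : 2 * h ≤ c) :
    2 * ((h + 1) * c ^ h) < (c + 2) ^ (h + 1) := by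
  have h2 : c ^ h < (c + 2) ^ h := Nat.pow_lt_pow_left (by omega) (by omega)
  calc 2 * ((h + 1) * c ^ h) = (2 * (h + 1)) * c ^ h := by ring
    _ ≤ (c + 2) * c ^ h := Nat.mul_le_mul_right _ (by omega)
    _ < (c + 2) * (c + 2) ^ h := Nat.mul_lt_mul_of_pos_left h2 (by omega)
    _ = (c + 2) ^ (h + 1) := by rw [pow_succ']

/-- The comparison `2 E(j) < M E(j')` for geometric sums with ratios `j M`, `j' M`, given the
numerical inequality `2 (h+1) c^h < M` for a common bound `c` of the `j`'s. -/
theorem two_mul_geom_sum_lt (M h c j j' : ℕ) (hM : 1 ≤ M) (hj1 : 1 ≤ j) (hj : j ≤ c)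
    (hj' : 1 ≤ j') (hkey : 2 * ((h + 1) * c ^ h) < M) :
    2 * ∑ k ∈ Finset.range (h + 1), (j * M) ^ k <
      M * ∑ k ∈ Finset.range (h + 1), (j' * M) ^ k := by
  have hup : ∑ k ∈ Finset.range (h + 1), (j * M) ^ k ≤ (h + 1) * (c ^ h * M ^ h) :=
    calc ∑ k ∈ Finset.range (h + 1), (j * M) ^ k ≤ (h + 1) * (j * M) ^ h :=
          geom_sum_le _ _ (Nat.one_le_iff_ne_zero.mpr (Nat.mul_ne_zero (by omega) (by omega)))
      _ ≤ (h + 1) * (c * M) ^ h :=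
          Nat.mul_le_mul_left _ (Nat.pow_le_pow_left (Nat.mul_le_mul_right _ hj) h)
      _ = (h + 1) * (c ^ h * M ^ h) := by rw [mul_pow]
  have hlow : M ^ h ≤ ∑ k ∈ Finset.range (h + 1), (j' * M) ^ k :=
    le_trans (Nat.pow_le_pow_left (Nat.le_mul_of_pos_left M hj') h) (pow_le_geom_sum _ _)
  calc 2 * ∑ k ∈ Finset.range (h + 1), (j * M) ^ k ≤ 2 * ((h + 1) * (c ^ h * M ^ h)) :=
        Nat.mul_le_mul_left 2 hup
    _ = 2 * ((h + 1) * c ^ h) * M ^ h := by ring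
    _ < M * M ^ h := Nat.mul_lt_mul_of_pos_right hkey (pow_pos (by omega) h)
    _ ≤ M * ∑ k ∈ Finset.range (h + 1), (j' * M) ^ k := Nat.mul_le_mul_left M hlow

/-- `n² ≤ 2ⁿ` for `n ≥ 4`. -/
theorem sq_le_two_pow (n : ℕ) (hn : 4 ≤ n) : n ^ 2 ≤ 2 ^ n := by
  induction n, hn using Nat.le_induction with
  | base => norm_num
  | succ n hn ih =>
    calc (n + 1) ^ 2 ≤ 2 * n ^ 2 := by nlinarith
      _ ≤ 2 * 2 ^ n := Nat.mul_le_mul_left 2 ih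
      _ = 2 ^ (n + 1) := by rw [pow_succ']

/-- For `m ≥ 16`: `1 ≤ ⌊log₂ m⌋² ≤ m`. -/
theorem one_le_log_sq_and_le (m : ℕ) (hm : 16 ≤ m) :
    1 ≤ Nat.log 2 m ^ 2 ∧ Nat.log 2 m ^ 2 ≤ m := by
  have hL : 4 ≤ Nat.log 2 m := Nat.le_log_of_pow_le (by norm_num) hm
  refine ⟨Nat.one_le_pow _ _ (by omega), ?_⟩
  calc Nat.log 2 m ^ 2 ≤ 2 ^ Nat.log 2 m := sq_le_two_pow _ hL
    _ ≤ m := Nat.pow_log_le_self 2 (by omega)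

end ExpoCongruence

/-- **Registered stub `stub_expoCongruence`** (skeleton v2 of the line `registered`, crux
`BinomialElusive.BinomialCandidate`): for `m ≥ 16` and `1 ≤ j, j' ≤ 2m`, with `h = ⌊log₂ m⌋²` and
`M = (2m+2)^{h+1}`, the exponent `E_m(j) = Σ_{k ≤ h} (jM)^k` satisfies `E_m(j) % M = 1` and
`2 E_m(j) < M · E_m(j')`. -/
theorem stub_expoCongruence :
    ∃ m₀ : ℕ, ∀ m ≥ m₀, ∀ j j' : ℕ, 1 ≤ j → j ≤ 2 * m → 1 ≤ j' → j' ≤ 2 * m →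
      (∑ k ∈ Finset.range (Nat.log 2 m ^ 2 + 1), (j * (2 * m + 2) ^ (Nat.log 2 m ^ 2 + 1)) ^ k) %
          (2 * m + 2) ^ (Nat.log 2 m ^ 2 + 1) = 1 ∧
        2 * (∑ k ∈ Finset.range (Nat.log 2 m ^ 2 + 1),
            (j * (2 * m + 2) ^ (Nat.log 2 m ^ 2 + 1)) ^ k) <
          (2 * m + 2) ^ (Nat.log 2 m ^ 2 + 1) *
            (∑ k ∈ Finset.range (Nat.log 2 m ^ 2 + 1),
              (j' * (2 * m + 2) ^ (Nat.log 2 m ^ 2 + 1)) ^ k) := by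
  refine ⟨16, fun m hm j j' hj1 hj hj'1 _ => ?_⟩
  obtain ⟨hh1, hhm⟩ := ExpoCongruence.one_le_log_sq_and_le m hm
  set h := Nat.log 2 m ^ 2 with hh
  have hM : 2 ≤ (2 * m + 2) ^ (h + 1) :=
    le_trans (by omega) (Nat.le_self_pow (Nat.succ_ne_zero h) (2 * m + 2))
  refine ⟨?_, ?_⟩
  · rw [ExpoCongruence.geom_sum_mul_mod, Nat.mod_eq_of_lt hM]
  · exact ExpoCongruence.two_mul_geom_sum_lt _ h (2 * m) j j' (by omega) hj1 hj hj'1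
      (ExpoCongruence.two_mul_succ_mul_pow_lt (2 * m) h hh1 (by omega))

end Summit.ValiantsHypothesis.ValiantsHypothesis.Theorems.BinomialCandidateStubs
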